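import Summits.QuantumAdvantage.AdviceFreeQNC0.WindowLocalization
import Mathlib.Analysis.SpecialFunctions.Log.Base
import HarnessLib

/-!
# Cell qa-qnc0 (rung F-Q1, route RingFrame, crux α `RingToElim` / density target T10): the MANY-BLOCKS
# reduction of planner qa-qnc0-p1's ROUND-12 — statements (Sketch13 VERBATIM) and `TensorMultPays`

Planner qa-qnc0-p1 gen 13 (ROUND-12 §2, `HOME/qa-qnc0-p1/Sketch13.lean`, ask P18).  Cut `[n]` into `k`
consecutive blocks (`blockIdx n k i = ⌊i·k/n⌋`); a degree-`D` walk strategy with `D < (t+1)(k−1)` has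
its WIN pattern in the `k`-block SUM CODE at block degree `t` (`BlockSplit t`, proved in
`TensorBlockSplit.lean`); TENSOR MULTIPLICATIVITY `TensorMult t β` (every such pattern fails on
`≥ β^k·2ⁿ` inputs, uniformly in `k`) is the conjecture family; and the arithmetic of this file:

* **`tensorMultPays : TensorMultPays`** (Sketch13 VERBATIM) — for every block degree `t` and every
  ratio `β > 2^{-(t+1)}`: `BlockSplit t → TensorMult t β → T10W`.  Proof (ROUND-12 §2.2): with
  `β' = min β 1 = 2^{L}`, `−(t+1) < L ≤ 0`, take `k = ⌊D/(t+1)⌋ + 2` blocks; `D < (t+1)(k−1)`, the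
  blocks have sizes `≥ m₀` once `n ≥ (3m₀+3)·D`, and `β'^k = 2^{Lk} ≥ 2^{−cD}` for
  `c = (1 + c₀)/2 < 1`, `c₀ = −L/(t+1)`, as soon as `D ≥ −4L/(1−c₀)`.
* `multOnePays : MultOnePays` — the corollary shape at `t = 1` (`2^{-2} = 1/4`).

All `def`s below are the planner's Sketch13 text VERBATIM (`blockIdx`, `mergeBlock`, `blockWt`,
`HasBlockDeg`, `IsBlockElim`, `SumCodeWin`, `failCount`, `BlockSplit`, `TensorMult`, `TensorMultZeroAll`,
`TensorMultOne`, `RingFailLinearWalk`, `T10W`, `TensorMultPays`, `MultOnePays`).  The cell's statements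
(not in print).  WHAT THIS IS NOT: `TensorMult 1 β` for any `β > 1/4` (`TensorMultOne`, the crux MULT₁)
is OPEN; `T10W`, T10, crux α untouched; no separation.
-/

noncomputable section

namespace Summit.QuantumAdvantage.AdviceFreeQNC0

open Finset
open Literature.Computability.MetaComplexity Literature.Computability.MetaComplexity.Smolensky

/-! ### Sketch13 statements (verbatim) -/

/-- Block index of coordinate `i` when `[n]` is cut into `k` consecutive blocks (block `j` =
`{i : ⌊i·k/n⌋ = j}`, sizes `⌊n/k⌋` or `⌈n/k⌉`).  (Planner qa-qnc0-p1 Sketch13, verbatim.) -/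
def blockIdx (n k : ℕ) (i : Fin n) : ℕ := i.val * k / n

/-- Replace the block-`j` bits of `v` by those of `w`.  (Sketch13, verbatim.) -/
def mergeBlock (n k j : ℕ) (v w : Fin n → Bool) : Fin n → Bool :=
  fun i => if blockIdx n k i = j then w i else v i

/-- Hamming weight of block `j`.  (Sketch13, verbatim.) -/
def blockWt (n k j : ℕ) (u : Fin n → Bool) : ℕ :=
  (univ.filter fun i : Fin n => blockIdx n k i = j ∧ u i = true).card

/-- `T` has degree `≤ t` IN THE BLOCK-`j` BITS (all other bits fixed arbitrarily).  (Sketch13, verbatim.) -/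
def HasBlockDeg (n k j t : ℕ) (T : (Fin n → Bool) → Bool) : Prop :=
  ∀ v : Fin n → Bool, HasDeg (fun w => T (mergeBlock n k j v w)) t

/-- On every block-`j` fibre, `X` is the win pattern of an EVEN ELIMINATOR TRIPLE of block-degree `≤ t`
(TARGET §17.1 normal form): `X(u) = T_{|u_j| mod 3}(u)`, `T₀ ⊕ T₁ ⊕ T₂ ≡ 0`.  (Sketch13, verbatim.) -/
def IsBlockElim (n k j t : ℕ) (X : (Fin n → Bool) → Bool) : Prop :=
  ∃ T : ℕ → (Fin n → Bool) → Bool,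
    (∀ r, HasBlockDeg n k j t (T r)) ∧
    (∀ u, xor (T 0 u) (xor (T 1 u) (T 2 u)) = false) ∧
    ∀ u, X u = T (blockWt n k j u % 3) u

/-- `win` lies in the coset structure of the `k`-block SUM CODE at block degree `t`:
`win = ⊕_{j<k} X_j` with every `X_j` a block-`j` eliminator pattern.  (Sketch13, verbatim.) -/
def SumCodeWin (n k t : ℕ) (win : (Fin n → Bool) → Bool) : Prop :=
  ∃ X : ℕ → (Fin n → Bool) → Bool, (∀ j < k, IsBlockElim n k j t (X j)) ∧
    ∀ u, win u = decide (((range k).filter fun j => X j u = true).card % 2 = 1)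

/-- Number of inputs on which a win pattern FAILS.  (Sketch13, verbatim.) -/
def failCount {n : ℕ} (win : (Fin n → Bool) → Bool) : ℕ :=
  (univ.filter fun u : Fin n → Bool => win u = false).card

/-- **BLOCK SPLITTING at block degree `t`** (TARGET §16.1 for general `k`): a degree-`D` walk strategy
on `n` bits cut into `k ≤ n` consecutive blocks with `D < (t+1)(k−1)` has its WIN pattern (`ringWinU`,
every charge) in the `k`-block sum code at block degree `t`.  (Sketch13, verbatim; proved in
`TensorBlockSplit.lean`.) -/
def BlockSplit (t : ℕ) : Prop :=
  ∀ (n k D c : ℕ) (y : Fin (n + 1) → (Fin n → Bool) → Bool),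
    0 < k → k ≤ n → D < (t + 1) * (k - 1) → (∀ g, HasDeg (y g) D) →
      SumCodeWin n k t (ringWinU c y)

/-- **TENSOR MULTIPLICATIVITY with ratio `β` at block degree `t`, uniform in the number of blocks**:
every element of the coset of `𝟙` modulo the `k`-block sum code (blocks of sizes `≥ m₀`) has weight
`≥ β^k·2ⁿ = Π_j β·2^{m_j}`.  CONJECTURE for `t ≥ 1`.  (Sketch13, verbatim.) -/
def TensorMult (t : ℕ) (β : ℝ) : Prop :=
  ∃ m₀ : ℕ, ∀ (n k : ℕ), 0 < k → m₀ * k ≤ n → ∀ win : (Fin n → Bool) → Bool,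
    SumCodeWin n k t win → β ^ k * (2 : ℝ) ^ n ≤ (failCount win : ℝ)

/-- **Degree-0 multiplicativity for any number of blocks** (TARGET §16.0(iv)/§16.3 P3): the witness
rung.  (Sketch13, verbatim; proved in `TensorMultZero.lean`.) -/
def TensorMultZeroAll : Prop := ∀ β : ℝ, β < 1 / 3 → TensorMult 0 β

/-- **MULT₁ — the new crux**: multiplicativity at block degree ONE beyond the payoff threshold `1/4`.
OPEN.  (Sketch13, verbatim.) -/
def TensorMultOne : Prop := ∃ β : ℝ, 1 / 4 < β ∧ TensorMult 1 β

/-- `T10` in WALK form with base-2 exponent `c`: for `D ≥ D₀` and every `n ≥ λ·D`, every degree-`D`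
walk strategy (every charge) wins on `≤ (1 − 2^{-cD})·2ⁿ` inputs.  (Sketch13, verbatim.) -/
def RingFailLinearWalk (c : ℝ) : Prop :=
  ∃ lam D₀ : ℕ, ∀ D ≥ D₀, ∀ n ≥ lam * D, ∀ (ch : ℕ) (y : Fin (n + 1) → (Fin n → Bool) → Bool),
    (∀ g, HasDeg (y g) D) →
      ((univ.filter fun u : Fin n → Bool => ringWinU ch y u = true).card : ℝ)
        ≤ (1 - (2 : ℝ) ^ (-(c * (D : ℝ)))) * (2 : ℝ) ^ n

/-- **T10W**: some exponent `c < 1` (the circuit-payoff threshold of ROUND-11 §1.3(ii)).  OPEN.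
(Sketch13, verbatim.) -/
def T10W : Prop := ∃ c : ℝ, c < 1 ∧ RingFailLinearWalk c

/-- **THE REDUCTION**: multiplicativity beyond `2^{-(t+1)}` at any single block degree `t` pays `T10W`.
(Sketch13, verbatim; proved below.) -/
def TensorMultPays : Prop :=
  ∀ (t : ℕ) (β : ℝ), (2 : ℝ) ^ (-((t : ℝ) + 1)) < β → BlockSplit t → TensorMult t β → T10W

/-- Corollary shape at `t = 1`: `BlockSplit 1 → TensorMultOne → T10W`.  (Sketch13, verbatim.) -/
def MultOnePays : Prop := BlockSplit 1 → TensorMultOne → T10W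

/-! ### The reduction -/

namespace TensorBlocks

/-- `failCount win + #WIN = 2ⁿ`. [folklore] -/
theorem failCount_add_card_win {n : ℕ} (win : (Fin n → Bool) → Bool) :
    failCount win + (univ.filter fun u : Fin n → Bool => win u = true).card = 2 ^ n := by
  unfold failCount
  have h := Finset.card_filter_add_card_filter_not
    (s := (univ : Finset (Fin n → Bool))) (fun u : Fin n → Bool => win u = false)
  have e : (univ.filter fun u : Fin n → Bool => ¬ win u = false) =
      univ.filter fun u : Fin n → Bool => win u = true :=
    filter_congr fun u _ => by simp
  rw [e] at h
  rw [h, card_univ, Fintype.card_fun, Fintype.card_bool, Fintype.card_fin]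

/-- The block count `k = ⌊D/(t+1)⌋ + 2` satisfies `D < (t+1)(k−1)`. [folklore] -/
theorem lt_blocks (D t : ℕ) : D < (t + 1) * (D / (t + 1) + 1) := by
  have h := Nat.lt_div_mul_add (a := D) (show 0 < t + 1 by omega)
  rw [Nat.mul_add, Nat.mul_one, Nat.mul_comm]
  exact h

end TensorBlocks

open TensorBlocks

/-- **`TensorMultPays` — PROVED** (ROUND-12 §2.2 arithmetic): `2^{-(t+1)} < β`, `BlockSplit t` and
`TensorMult t β` give `T10W` with exponent `c = (1 + c₀)/2`, `c₀ = log₂(1/min(β,1))/(t+1) < 1`,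
`k = ⌊D/(t+1)⌋ + 2` blocks, `λ = 3m₀ + 3`.  The cell's theorem (qa-qnc0-p1 ROUND-12, ask P18). -/
theorem tensorMultPays : TensorMultPays := by
  classical
  intro t β hβ hBS hTM
  obtain ⟨m₀, hm₀⟩ := hTM
  have htR : (0 : ℝ) < (t : ℝ) + 1 := by positivity
  -- `β' = min β 1 = 2^L`, `-(t+1) < L ≤ 0`
  set β' : ℝ := min β 1 with hβ'
  have h2pow : (0 : ℝ) < (2 : ℝ) ^ (-((t : ℝ) + 1)) := Real.rpow_pos_of_pos two_pos _
  have hβ'gt : (2 : ℝ) ^ (-((t : ℝ) + 1)) < β' :=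
    lt_min hβ (Real.rpow_lt_one_of_one_lt_of_neg one_lt_two (by linarith))
  have hβ'pos : 0 < β' := h2pow.trans hβ'gt
  have hβ'le1 : β' ≤ 1 := min_le_right _ _
  have hβ'leβ : β' ≤ β := min_le_left _ _
  set L : ℝ := Real.logb 2 β' with hL
  have hLle : L ≤ 0 := Real.logb_nonpos one_lt_two hβ'pos.le hβ'le1
  have hLgt : -((t : ℝ) + 1) < L := by
    have := Real.logb_lt_logb one_lt_two h2pow hβ'gt
    rwa [Real.logb_rpow two_pos (by norm_num)] at this
  have hβ'L : β' = (2 : ℝ) ^ L := (Real.rpow_logb two_pos (by norm_num) hβ'pos).symm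
  -- the exponent
  set c₀ : ℝ := -L / ((t : ℝ) + 1) with hc₀
  have hc₀lt : c₀ < 1 := by
    rw [hc₀, div_lt_one htR]; linarith
  have hc₀nn : 0 ≤ c₀ := by rw [hc₀]; exact div_nonneg (by linarith) htR.le
  have hc₀L : c₀ * ((t : ℝ) + 1) = -L := by rw [hc₀]; field_simp
  refine ⟨(c₀ + 1) / 2, by linarith, 3 * m₀ + 3, ⌈-(4 * L) / (1 - c₀)⌉₊ + 1, ?_⟩
  intro D hD n hn ch y hdeg
  have hD1 : 1 ≤ D := by omega
  have hDR : (-(4 * L) / (1 - c₀) : ℝ) ≤ D := by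
    have h1 : ((⌈-(4 * L) / (1 - c₀)⌉₊ : ℕ) : ℝ) ≤ D := by
      have : ⌈-(4 * L) / (1 - c₀)⌉₊ ≤ D := by omega
      exact_mod_cast this
    exact (Nat.le_ceil _).trans h1
  have hDR' : -(4 * L) ≤ (1 - c₀) * D := by
    rw [div_le_iff₀ (by linarith)] at hDR; linarith
  -- the blocks
  obtain ⟨q, hq⟩ : ∃ q : ℕ, q = D / (t + 1) := ⟨_, rfl⟩
  have hqD : q ≤ D := by rw [hq]; exact Nat.div_le_self D (t + 1)
  have hDq : D < (t + 1) * (q + 1) := by rw [hq]; exact lt_blocks D t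
  set k : ℕ := q + 2 with hk
  have hk0 : 0 < k := by omega
  have hkD : k ≤ D + 2 := by omega
  have hnD : (3 * m₀ + 3) * D ≤ n := hn
  have hkn : k ≤ n := by nlinarith
  have hm₀k : m₀ * k ≤ n := by nlinarith
  have hDk : D < (t + 1) * (k - 1) := by
    have e : k - 1 = q + 1 := by omega
    rw [e]; exact hDq
  -- block splitting and multiplicativity
  have hSC := hBS n k D ch y hk0 hkn hDk hdeg
  have hfail := hm₀ n k hk0 hm₀k _ hSC
  have hsum := failCount_add_card_win (ringWinU ch y)
  have hsumR : (failCount (ringWinU ch y) : ℝ) +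
      ((univ.filter fun u : Fin n → Bool => ringWinU ch y u = true).card : ℝ) = (2 : ℝ) ^ n := by
    exact_mod_cast hsum
  -- `2^{-(cD)} ≤ β'^k ≤ β^k`
  have hββ' : β' ^ k ≤ β ^ k := pow_le_pow_left₀ hβ'pos.le hβ'leβ k
  have hkR : ((k : ℕ) : ℝ) ≤ (D : ℝ) / ((t : ℝ) + 1) + 2 := by
    have h1 : (q : ℝ) ≤ (D : ℝ) / ((t : ℝ) + 1) := by
      rw [le_div_iff₀ htR]
      have : q * (t + 1) ≤ D := by rw [hq]; exact Nat.div_mul_le_self D (t + 1)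
      exact_mod_cast this
    rw [hk]; push_cast; linarith
  have hexp : -((c₀ + 1) / 2 * (D : ℝ)) ≤ L * k := by
    -- `L·k ≥ L·(D/(t+1) + 2) = -c₀·D + 2L ≥ -((c₀+1)/2)·D` for `D ≥ -4L/(1-c₀)`
    have h1 : L * ((D : ℝ) / ((t : ℝ) + 1) + 2) ≤ L * k := mul_le_mul_of_nonpos_left hkR hLle
    have h2 : L * ((D : ℝ) / ((t : ℝ) + 1) + 2) = -(c₀ * D) + 2 * L := by
      rw [hc₀]; ring
    linarith
  have hpow : (2 : ℝ) ^ (-((c₀ + 1) / 2 * (D : ℝ))) ≤ β' ^ k := by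
    rw [hβ'L, ← Real.rpow_natCast, ← Real.rpow_mul (by norm_num : (0 : ℝ) ≤ 2)]
    exact Real.rpow_le_rpow_of_exponent_le one_le_two hexp
  have h2n : (0 : ℝ) ≤ (2 : ℝ) ^ n := by positivity
  have hchain : (2 : ℝ) ^ (-((c₀ + 1) / 2 * (D : ℝ))) * (2 : ℝ) ^ n ≤
      (failCount (ringWinU ch y) : ℝ) :=
    le_trans (mul_le_mul_of_nonneg_right (hpow.trans hββ') h2n) hfail
  linarith

/-- **`MultOnePays` — PROVED**: `BlockSplit 1 → TensorMultOne → T10W` (`2^{-2} = 1/4`). -/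
theorem multOnePays : MultOnePays := by
  intro hBS hM
  obtain ⟨β, hβ, hTM⟩ := hM
  refine tensorMultPays 1 β ?_ hBS hTM
  have h : (2 : ℝ) ^ (-(((1 : ℕ) : ℝ) + 1)) = 1 / 4 := by
    rw [show (-(((1 : ℕ) : ℝ) + 1) : ℝ) = -((2 : ℕ) : ℝ) by norm_num,
      Real.rpow_neg (by norm_num), Real.rpow_natCast]
    norm_num
  rw [h]
  exact hβ

end Summit.QuantumAdvantage.AdviceFreeQNC0
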